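import Mathlib
import Summits.Ventures.FusionMHD.Models.CerfonFreidbergIterLikeQHalfMercDefs
import HarnessLib

/-!
# Ventures/FusionMHD — Models/CerfonFreidbergIterLikeQHalfMercPanels10.lean: KERNEL CHECK of the Mercier-register certificates of panel(s) 16, 17 (of 32)
# at `ψ_N = 1/2` of THE Cerfon–Freidberg ITER-like instance

HONEST FRAMING (LADDER-GRIDFUSION three columns; CF rung; «F2.R2-CF-MERCIER-IMPLICIT» step (2), F2-SCOPING v1.6 §10(c)).  One `decide +kernel` (≈ 100 s): for each
listed panel the obligation `CFIterLike.QHalfMerc.MercCert.ok` (`Models/CerfonFreidbergIterLikeQHalfMercDefs.lean`) — the Taylor-model run of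
`progM = progA ++ block1 ++ block2 ++ block3M` over ★ #117's parameter box is ACCEPTED (both `inv` certificates included) and the kernel's FOUR panel-integral
enclosures (`g_W`, `g_Aσ`, `g_AR`, `g_B1` along the approximant) lie inside the claimed integers (read off a compiled `#eval` of the same functions, slack one unit of
`2⁻⁶⁰`; float truth inside every panel, `HOME/models/model-7/g7/genqm/truthM.json`).  MODELLED: analytic Cerfon–Freidberg family; nothing about a device or
stability.  No `native_decide`.  Typer/prover: gridfusion-model-7 (g7), 2026-08-27.
Citations: Jardin 2010 §8.5 (8.134) [Jardin2010]; Mahboubi–Melquiond–Sibut-Pinote 2016 §3.2 Lemma 3 [MahboubiMelquiondSibutpinote2016].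
-/

namespace Summit.Ventures.FusionMHD.Models.CFIterLike.QHalfMerc

/-- Mercier-register certificate data of panel(s) 16, 17. [instance data] -/
def mercCert10 : List MercCert := [
  { j := 16, cand1 := [1053742565972949073920, 11260024785821587472384, 56759821329612138348544, -22462769038148235165696, -2609139275242126614462464, -18945682092539328600211456, -33024470036442960957014016, 532741899575887130206928896, 5180682151178635040438353920, 15603842480792478555207368704, -89271660446700780497655562240, -1177921097444652438661273485312, -13151460019403251227070711201792],
    cand2 := [934736532379502510080, 11406019400468424294400, 74713993682452482097152, 43522157503866747224064, -4685640675113404727296000, -53281198450392204352421888, -245484239487647643630305280, 1053418916636178700482641920, 28007241044176542740365967360, 224504051444223061077987950592, 463227198566001832767204098048, -10999147394301028806054706675712, -149228215978130701030679847632896],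
    deg := 10, e1 := 45, e2 := 45, wlo := 1007574814069188255, whi := 1007575027568319030, slo := 34402030191137640592, shi := 34402032911904441763,
    rlo := 36288002072596877594, rhi := 36288005054566553341, blo := 32626815239722052528, bhi := 32626817815844214097 },
  { j := 17, cand1 := [1457299232202230857728, 14331727753217979711488, 33590636983176814133248, -526672736130316187467776, -5112072722789491913261056, -4825608770458063627878400, 225781481070982717503438848, 1560817292238879400136802304, -1974256227761468961745534976, -86417906632058655284651884544, -391557939105819423664014098432, 1945190411371678871309068009472, 27216304067560397221600339951616],
    cand2 := [1359243094265678266368, 15348410666109292773376, 33184881883909443289088, -1113893107040605217751040, -12855682989844542645075968, -7814655616355386829832192, 1129543576270585658909655040, 10443760572399271783738376192, -15267417146888626201178406912, -1101208202752569189810892177408, -7994527120974346531592720089088, 37608326020644680859914975838208, 992010942365812611005806274412544],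
    deg := 10, e1 := 46, e2 := 46, wlo := 2709451380650310681, whi := 2709451856395589644, slo := 47857573180861778813, shi := 47857578477222177520,
    rlo := 47006536658242485237, rhi := 47006542090427491754, blo := 48746069302852438906, bhi := 48746074585500665991 }]

/-- **KERNEL CHECK** of the four Mercier registers on panel(s) 16, 17. -/
theorem mercCert10_ok : CFIterLike.QHalfMerc.mercCert10.all MercCert.ok = true := by
  decide +kernel

end Summit.Ventures.FusionMHD.Models.CFIterLike.QHalfMerc
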